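import Summits.CriticalPhenomena.SAWScalingLimit.Theorems.SAWTotalPositivityTPToTraversalBoundExitMassDefs
import Summits.CriticalPhenomena.SAWScalingLimit.Theorems.SAWTotalPositivityTPToTraversalBoundDiveDefs
import Summits.CriticalPhenomena.SAWScalingLimit.Theorems.SAWTotalPositivityTPToTraversalBoundCriticalExitMass
import Summits.CriticalPhenomena.SAWScalingLimit.Theorems.SAWTotalPositivityTPToTraversalBoundMultiDive
import Summits.CriticalPhenomena.SAWScalingLimit.Theorems.SAWTotalPositivityTPToTraversalBoundHasNTrav
import Summits.CriticalPhenomena.SAWScalingLimit.Theorems.SAWTotalPositivityTPToTraversalBoundTravSeq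

/-!
# Line `exit-mass-unforced-dive` for crux `SAWTotalPositivity.TPToTraversalBound` (stmt-CriticalPhenomena-10687)

Skeleton (crux-strategist / wall-breaker, planner-cstrat-stmt-CriticalPhenomena-10687-p1-0, 2026-08-17),
written AFTER the opening chain was declared exhausted (lines `radial-portal-transfer`, `critical-strip-gap`,
`power-law-tp2` dead; leads c1–c4; `Cruxes/TPToTraversalBound/STRATEGY-CENSUS.md`).

The crux is literally `BoundaryTP2 → CriticalBubbleBound → SAWTraversalBound` (`Disproof.iff_imp`), and
`SAWTraversalBound` (Aizenman–Burchard (H1) with a shell-dependent threshold) is per-shell tightness of the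
critical `ℤ²` SAW (`…Radial.shellTight_iff_traversalBound`, p105581).  Every dead line ended at the same
residual — a Kemppainen–Smirnov Condition-G2/G3 bound on UNFORCED annulus crossings of the chordal critical
SAW, uniform in the mesh and in the past — either disguised (`stub_shellTight` = the crux; `stub_boundaryShells`
= (H1) verbatim on boundary shells) or behind a seed that was false as typed (`TP2Gap`).  The four leads'
standing recommendation (crux NOTES.md, c1 (ii) / c3 / c4): "re-line the crux with an explicit SAW-specific
RSW/G2 seed as a conjecture-grade stub, typed with a mesh ceiling and a no-bottleneck proviso".

THE LINE (four registered stubs, composed at the bottom; sorries ONLY inside `stub_*`):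

* `stub_criticalExitMass` — **NEW, provable now (M): criticality as an inequality.**  For every bounded `Ω`,
  mesh `δ > 0` and site `p`:  `x_c · Σ_y e(y) · Z_{Ω_δ}(p, y) ≥ 1`, where `Z_{Ω_δ}(p,y) = SAW.weight Ω δ p y univ`
  and `e(y)` is the number of `ℤ²`-edges at `y` that are NOT edges of `Ω_δ` (`exteriorDegree`).  This is the
  contrapositive, at `x = x_c`, of the Lieb–Simon finite-size criterion by which upper bounds on `μ` are
  proved (if `x · Σ_y e_G(y) Z_G(p,y) < 1` for one finite subgraph `G ∋ p` of `ℤ²` then, decomposing every SAW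
  of `ℤ²` from a point at its first edge outside the translate of `G`, `χ_N(x) ≤ C_G/(1-φ)` uniformly in the
  truncation `N`, contradicting `χ_N(x_c) ≥ N + 1` from `c_n x_c^n ≥ 1`, i.e. the tree's
  `SAW.Zd.pow_connectiveConstant_le_count`).  It is the ONLY scale-free LOWER bound on tip-sourced boundary
  masses of the critical square-lattice SAW available without an exponent (Disproof BN1/BN2 record why every
  splitting/TP₂ chain needs one): from a slit tip `p` with `e(p) = k ≤ 2` exterior contacts,
  `Σ_{y ≠ p} e(y) Z(p,y) ≥ μ - k ≥ 0.6` (`μ ≥ 2.6` proved in tree).  No card, barrier note or dead line of this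
  crux used it (they use the `≤ 1` family only: Kesten/Hammersley–Welsh `B_T ≤ 1`).
* `stub_unforcedDive` — **THE SEED (XL, conjecture-grade, hardest): `BoundaryTP2 → CriticalBubbleBound →
  CriticalExitMass → UnforcedDiveBound`**, Kemppainen–Smirnov's Condition G3 for the chordal critical SAW on
  `δℤ²`, lattice-typed VERBATIM as in the crux-plan planner's Vocabulary B of `Lines/power-law-tp2.lean`
  (rc 0 there; a DIVE = a traversal of the annulus landing in `Targets` = index-increasing AND behind an
  avoidable component — both clauses needed: deep starts of `IsEndpointApprox` make every component avoidable,
  forced corridors make entering index-increasing; mesh ceiling `δ₀(D,a,b,ε)`, lattice-fat `r ≥ δ`).  Filed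
  OPENLY as the SAW-specific mesoscopic seed Disproof F4 demands (KS17 list the SAW's G2 as unverified; DKY14
  Problem 10) — not derived from a kernel inequality (that derivation was the bet that killed `power-law-tp2`).
  Named roles of the three tools in the intended attack (target-switching likelihood ratio + optional stopping,
  `Negative.optionalStoppingLR`, certified): TP₂ = the MLR sandwich that moves a likelihood ratio's source
  from the needle tip (boundary exponent 5/16, divergent arc sums — BN2) to a flat door post (5/8, convergent);
  B = one-step Harnack and the bubble tail (`Negative.bubbleTailDive`, certified) for dives through passages of
  bounded lattice width; CriticalExitMass = the lower bound on the likelihood ratio's NUMERATOR (tip-to-boundary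
  mass `≥ μ - 2`) — the step where every earlier scheme had nothing.  What stays open is stated in the stub's
  docstring (apportioning the exit mass between the dead end's walls and its door; the uniform-in-width climbing
  bound for the DENOMINATOR).
* `stub_multiDive_of_unforced` — nested optional stopping `UnforcedDiveBound → MultiDiveBound` (M; verbatim
  from `power-law-tp2`, never attacked there because that line died at its seed).
* `stub_traversalBound_of_multiDive` — lattice Kemppainen–Smirnov Prop. 3.5 / Lemma 3.6 + Aizenman–Burchard
  bookkeeping `UnforcedDiveBound → MultiDiveBound → SAWTraversalBound` (L–XL; verbatim from `power-law-tp2`; the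
  percolation twin `Literature.Probability.Percolation.bondExploration_traversalBound_holds` is PROVED in tree).
* `TPToTraversalBound_of` — the kernel-checked composition
  `fun hTP hB => let hU := stub_unforcedDive hTP hB stub_criticalExitMass; S4 hU (S3 hU)`.

Why this is not one of the dead lines again (step that died ↦ what is here instead):
`radial-portal-transfer` died at `stub_shellTight`, kernel-checked EQUIVALENT to the crux — here no stub is
implied by the crux: `UnforcedDiveBound` is a conditional bound uniform over all self-avoiding pasts at ONE
aspect ratio per `ε` (per-shell tightness of the unconditioned law does not give it), and the other three stubs are
implications; `critical-strip-gap` died owing (H1) verbatim on boundary-class shells — here pasts, `∂D` and the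
marked prime ends are all inside the one quantifier "every self-avoiding prefix `η`", there is no shell classifier;
`power-law-tp2` died at `stub_tp2Gap` (false on cycle graphs, F5) with G3 as a downstream bet — here there is no
kernel-gap stub at all, G3 is the declared seed, and the new provable content (`CriticalExitMass`) is an
inequality in the OPPOSITE direction to everything TP₂ can give (a lower bound at criticality).

Disproof.lean (v9) honoured: F1 — no `_false_without_` theorem exists (none can unless (H1) fails); the line USES
`BoundaryTP2`, `CriticalBubbleBound` (stub 2) and adds its own SAW-specific input (F4).  F2(iii)/F3 — thresholds
stay shell-dependent inside stub 4 (`k = 3 m_D + ⌈3 log₂(R/ρ)⌉ + 4`), constants per `(D,a,b)`.  F2(v)/§6 — deep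
starts: the index clause of `Targets`.  F6/F7 (`Negative/AnnulusPairingGapFalse`, `RimPushMonotoneFalse`) — no
pairing-gap or rim-push statement; every statement over a fixed continuum domain carries `δ ≤ δ₀`; `CriticalExitMass`
is typed over ALL bounded `Ω` and all `δ > 0` and is immune to coarse-mesh junk (checked: for `p ∉ Ω_δ` the nil walk
and `e(p) = 4` give `4x_c ≥ 1`; for `Ω_δ` a single site the same; sub-critical strips are finite graphs — the bound
is about the EXIT mass, not the internal susceptibility).  BN1/BN2 — the attack is through same-source likelihood
ratios only; `CriticalExitMass` enters a NUMERATOR lower bound, never an un-normalised tip mass upper bound.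
-/

namespace Summit.CriticalPhenomena.SAWScalingLimit.Cruxes.TPToTraversalBound.ExitMassUnforcedDive

open Literature.Probability.RandomPlanarGeometry Literature.Probability.LatticeModels
open Summit.CriticalPhenomena.SAWScalingLimit.Theses.SAWTotalPositivity
open Summit.CriticalPhenomena.SAWScalingLimit.Theorems.TPToTraversalBound.Negative (PrefixSet)
open Summit.CriticalPhenomena.SAWScalingLimit.Theorems.TPToTraversalBound.ExitMass
open scoped ENNReal

set_option linter.unusedVariables false

noncomputable section

/-! ## Vocabulary — LANDED (lead c5, 2026-08-17)

All objects and the two plumbing statements of this line now live in the tree and are imported, not restated: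
`Summits/CriticalPhenomena/SAWScalingLimit/Theorems/SAWTotalPositivityTPToTraversalBoundExitMassDefs.lean`
(`exteriorDegree`, `CriticalExitMass`, `exteriorDegree_le_four`; p137846, commit 9069e6721523) and
`…/SAWTotalPositivityTPToTraversalBoundDiveDefs.lean` (`rad`, `IsTraversal`, `HasNTrav`, `IdxAtLeast`, `InA`,
`JoinedInA`, `Avoidable`, `Targets`, `DiveSet`, `TravSeq`, `ChargedSet`, `UnforcedDiveBound`, `MultiDiveBound`,
`diveSet_subset_prefixSet`, `chargedSet_subset_prefixSet`; p137848, commit 023c4fdab643), namespace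
`Summit.CriticalPhenomena.SAWScalingLimit.Theorems.TPToTraversalBound.ExitMass` (opened below).  The texts are
VERBATIM those of the strategist's skeleton (sha 0a90ce1a…); landing names registered for the stubs:
`criticalExitMass`, `multiDiveBound_of_unforcedDiveBound`, `traversalBound_of_multiDiveBound`. -/

/-! ## Registered stubs -/

/-- **Stub 1 (M, provable now) — `CriticalExitMass`.**  Proof plan.  Put `G := discreteDomainGraph Ω δ` (finite:
`meshVertices_finite` for bounded `Ω`, `δ ≠ 0`; its vertices with an edge lie in `meshDomain Ω δ`) and
`φ := x_c Σ_y e(y) Z_G(p,y)`, `C := Σ_y Z_G(p,y) < ∞`.  Every SAW `ω` of `ℤ²` from `p` of length `≤ N` either is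
a walk of `G` (counted in `C`) or has a FIRST edge `(y,y')` not in `G`; its prefix `p ⇝ y` is a SAW of `G`, the
edge is one of the `e(y)` exterior edges at `y`, and the remainder is a SAW of `ℤ²` from `y'` of length `< N`
(injective decomposition, self-avoidance between the pieces dropped).  Hence with
`χ_N := Σ_{n ≤ N} c_n x_c^n` (translation invariant): `χ_N ≤ C + φ · χ_N`.  If `φ < 1` this gives
`χ_N ≤ C/(1-φ)` for all `N`, but `c_n x_c^n ≥ 1` (`x_c = μ⁻¹`, `μ^n ≤ c_n`:
`SAW.Zd.pow_connectiveConstant_le_count` with `Zd.connectiveConstant_two`) gives `χ_N ≥ N+1` — contradiction; so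
`φ ≥ 1`.  Lean work: the first-exit decomposition as an injection on the tree's list model of SAWs
(`SAW.Zd.IsSAW`, `pathsAt`, `SAWBubbleBound.lean` / `SAWMassNormFirstHit.lean` have the splitting API), the
identification `SAW.weight Ω δ p y univ = Σ_{G-paths p→y} x_c^{length}` (`weight_singleton`, `Measure.sum` of
Diracs on `⊤`), ENNReal/real bookkeeping (`criticalFugacity_pos_lt_one`).  Junk audit: `p ∉ Ω_δ` ⇒ the nil walk
and `e(p) = 4` give `4x_c ≥ 1` (true: `x_c ≥ 1/3`, `connectiveConstant_le_three`); unbounded `Ω` excluded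
(for `Ω = ℂ`, `e ≡ 0`).  Why it might fail: only through a mismatch between `discreteDomainGraph` edges and the
`ℤ²` edges used in the decomposition — none: `G ≤ zdGraph 2` edge-wise and the argument is stated for an arbitrary
finite subgraph.  Sources: B. Simon, Commun. Math. Phys. 77 (1980) 111–126 and E. H. Lieb, ibid. 127–135 (finite-size
criteria for spin systems: "exit functional < 1 ⇒ exponential decay"); for the SAW the same first-exit decomposition is
Hammersley's sub-multiplicativity localised to a domain, MadrasSlade1993 §1.2 (with `μ^n ≤ c_n`, (1.2.10)); BDGS2012 §1.5. -/
theorem stub_criticalExitMass : CriticalExitMass :=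
  criticalExitMass  -- LANDED: p140507 (`…TPToTraversalBoundCriticalExitMass.lean`, with Aux p139900)

/-- **Stub 2 (XL, HARDEST — the declared seed) — `BoundaryTP2 → CriticalBubbleBound → CriticalExitMass →
UnforcedDiveBound`.**  Kemppainen–Smirnov Condition G3 for the chordal critical `ℤ²` SAW; OPEN (KS17 §1/§4 list
the SAW as the one classical model for which G2 is unverified; Duminil-Copin–Kozma–Yadin 2014 Problem 10).
Conjecturally true with power-law room: for an avoidable component `P` of modulus `m` the SLE_{8/3} / CFT
prediction for the dive probability is `≍ e^{-(5π/4) m}` (TWO strands must cross `P`: in and back out of the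
dead end; boundary exponent `h = 5/8`, strip gap `5π/8` per strand — the crux's own enumeration
`(w+1)a_w = 1.946, 1.949, 1.951 → 5π/8`), and avoidable components of `A(z₀, r, C₀ r)` of modulus `≤ m` number
`≤ 2πm/log C₀` (extremal length), so `Σ_P e^{-(5π/4)m(P)} → 0` as `C₀ → ∞`; toy data (card target-switching-smlr,
exact enumeration at `x_c`): `inf N_σ/N_ν = 3.5, 13, 39, 120` at dive aspect ¼…1, `≈ 40` at aspect 1 for slot
widths 2, 3, 4 (scale invariance), `≈ 1030–1150` at aspect 2.
INTENDED ATTACK (where each hypothesis enters; everything not named here is open):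
(1) Localise to one avoidable component `P` with dead end `Y` and one entrance time `ν` (stopping time); let `σ`
be the completion time of the traversal of `P`.  Target-switching likelihood ratio `N_t := Σ_{c∈J} W_c(ext γ[0,t]) /
W_{b δ}(ext γ[0,t])` with `J ⊆ Y` fixed at `ν` — a `P_b`-martingale by exact domain Markov; optional stopping
(`Negative.optionalStoppingLR`, CERTIFIED) gives `P_b(dive through P from this entrance) ≤ 1/q` once
`N_σ ≥ q·N_ν` on the event ("LOCAL SMLR"; the global-`J` version is false — two pockets of one annulus — and is
not used).  All four partition functions of local SMLR have the same mouth, so tip factors, dead-end areas and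
route distances cancel (BN1/BN2 evaded; balanced normal form).
(2) `BoundaryTP2` (MLR sandwich, cyclic order `(q, t, c, b)` in the slit domain realised as `discreteDomainGraph Ω' δ`
— Disproof F5: slits are invisible to `closure`): `N_σ ≥ N_σ(q_in)` and `N_ν ≤ N_ν(q_out)` for door POSTS
`q_in`, `q_out` of `P` — the likelihood ratio seen from the needle tip dominates / is dominated by the one seen from
a flat boundary post, which removes the tip (exponent 5/16, divergent arc sums) from the inequality;
`Negative.mirrorMonotone` (CERTIFIED) supplies the reflection cases.
(3) NUMERATOR of `N_σ(q_in)`: `Σ_{c∈J} Z_{V_σ}(q_in, c)` with `J` = the wall-adjacent vertices of `Y` — LOWER bound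
by `CriticalExitMass` applied to the sub-domain `Y_σ` (the dead end cut at its inner door `I`):
`x_c·(Σ_{walls} e·Z + Σ_{door} Z) ≥ 1`, so `Σ_J Z ≥ (1 − x_c·doorshare)/(3x_c)`; OPEN PIECE (a): the door share from a
door-CORNER post is `≤ θ_a < 1` uniformly in the width (exact enumeration, this seat, `w × w` dead ends, `w = 2…6`:
`x_c·doorshare = 0.543, 0.635, 0.692, 0.731, 0.757`, increments shrinking `×0.65`, apparent limit `≈ 0.81`; depth `2w`
changes the third decimal; from a MID-door source it is `0.54 → 0.996` and useless — hence the MLR transfer (2) to a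
corner post is load-bearing).  In half-plane terms (a) is an ARCH-MASS bound `x_c(1 + Σ_{L≥1} Z_ℍ(0, L)) < 1`-type
statement (corner exponent 5/4 + 5/8: summable with room heuristically; on the hexagonal lattice the strip identity of
Duminil-Copin–Smirnov bounds arch masses; on `ℤ²` open, cf. card mirror-monotone-decay §3).
(4) DENOMINATOR side: `Z_{V_σ}(q_in, b δ)` (re-cross the room `P'` narrowed by the strand) against `Z_{V_ν}(q_out, b δ)`.
OPEN PIECE (b'): ESCAPE MASS — from a boundary post, the `x_c`-mass of walks that cross a corridor of modulus `≥ m` and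
are stopped on first arrival at its far door is `≤ θ(m) → 0` uniformly in the lattice width (both ends boundary-type,
so the arc sum CONVERGES, `≍ e^{-(5π/8)m}(|O|/δ)^{-1/4}` heuristically; exact enumeration, this seat, `w × L` boxes,
entry mid-bottom, stopped at the top row: aspect 1: `0.523, 0.419, 0.340, 0.309, 0.277` for `w = 2…6` (decreasing in
`w`), aspect 2: `0.143, 0.098, 0.072` (`w = 2,3,4`); every fixed width: strip subcriticality `μ_w < μ`; widths `≤ w₀`:
`CriticalBubbleBound` + `Negative.bubbleTailDive`; rigorous for all widths only `≤ B_{L-1}(x_c) ≤ 1`).  OPEN PIECE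
(c''): MOUTH HARNACK — after the escape the remainder of the walk starts at an INTERIOR point `o` of the outer door,
and `Z_{V_ν}(o, b δ)` must be compared with `Z_{V_ν}(q_out, b δ)` from the door POST: a lower bound of
quasi-multiplicativity type (`inf Z(q_out,b)/sup_o Z(o,b) ≥ c₁ δ^{25/48}`-shaped heuristically, i.e. NOT scale-free as a
pointwise statement — this is exactly where BN1 bites; the escape must therefore be stopped at a BOUNDARY point (the
long-rooms door lemma `Z(s,b)·Z(q,q') ≤ Z(s,q)·Z(q',b)`, one TP₂ instance, moves the source to a post at the price of a
post-to-post kernel `Z(q,q')` in the denominator, whose lower bound is again (c'')).  (c'') is the irreducible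
LOWER-bound residue of the line; (a) and (b') are upper bounds of arch/bridge type.
(5) Sum over pockets and entrances (extremal-length count, discrete) and pass to the "ever" form (a target judged at
`η` keeps index `≥ I(v)+1` as the past grows).
Why it might fail: (a)+(b')+(c'') are a two-sided control of critical corridor masses uniform in the width — the RSW
content; the bet of THIS line is only that the exit-mass lower bound makes the numerator side a `≤ const` statement
((a), the direction in which SAW inequalities exist) and confines the unavoidable lower bound to ONE place, (c'').  Cheapest falsifier: the seed is per
`(D,a,b)` with `∃ δ₀`, so no finite certificate; numerically, MCMC (lead 0's `cleanContraction_exp/ctm` BFACF+pivot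
code) of the dive frequency through a slot pocket of aspect 2 hanging off the unit disc at `δ = 1/32 … 1/128`
must stay bounded away from 1 and roughly mesh-independent; for piece (a): exact enumeration of the door share of
the exit mass from a door-corner post in `w × w` and `w × 2w` dead ends, `w = 7 … 12` by transfer matrix (the
`w ≤ 6` values above must keep converging below 1).  Sources: arXiv:1212.6215
Def. 2.2, Prop. 2.5, Remark 2.8, §3.2; AizenmanBurchardDuke1999; cards target-switching-smlr / power-law-tp2
(Cruxes/TPToTraversalBound/Ideas); Disproof v9 F4, F9, F10, BN1–BN2; MadrasSlade1993 §1.2, §1.5;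
DuminilCopinKozmaYadin2014 (Problem 10); KemppainenSmirnov2017. -/
theorem stub_unforcedDive :
    BoundaryTP2 → CriticalBubbleBound → CriticalExitMass → UnforcedDiveBound := by
  sorry

/-- **Stub 3 (M) — nested optional stopping: `UnforcedDiveBound → MultiDiveBound`** (same `C₀(ε), δ₀(ε)`).
Induction on `p`.  Decompose the charged-window event along the antichain of prefixes `η ++ q[0, E (mj 0)]`
(canonical clock times are progressively determined, so chords with different prefixes there are disjoint);
inside one such prefix `η'` the first charge is a sub-event of `DiveSet … (rch 0) (Rch 0) η' (b δ)`, weight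
`≤ ε · W(ext η')` by the hypothesis AT `η'`; its completion before `E (mj 1)` makes it decided by the next judging
prefix, inside which the remaining `p - 1` charges are bounded by the induction hypothesis applied at that prefix
(the statement is uniform in `η`); sum back (`Σ_{η'} W(ext η') ≤ W(ext η)`).  Lean work:
`Walk.take/drop/append/getVert` bookkeeping, heredity of `TravSeq` under `drop`, `weight` = sum of Diracs on `⊤`,
ENNReal sums; `Negative.optionalStoppingLR` is the summation pattern.  Why it might fail: only bookkeeping (the
window form was designed for this induction by the `power-law-tp2` planner).  Sources: arXiv:1212.6215 p. 11
(G2 ⇒ G3); AizenmanBurchardDuke1999 §2.d; `Lines/power-law-tp2.lean` stub 4 (verbatim). -/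
theorem stub_multiDive_of_unforced : UnforcedDiveBound → MultiDiveBound :=
  multiDiveBound_of_unforcedDiveBound  -- LANDED: p142312 (`…TPToTraversalBoundMultiDive.lean`, Aux p141955)

/-- **STATUS (lead c5, 2026-08-17, session 4): REGISTERED PLAN DEAD — handed back as crux-sized (promote-stub).**
Step (ii) below ("the `A₂`-index changes by `±1`; `n` traversals carry `≥ (n - n₀)/2` charges") is FALSE on the lattice,
and so is every weakening "`n` clock traversals ⇒ `≥ p(n) → ∞` charges among ANY family of SAME-CENTRE annuli": the
comb/snake walks `q_s` (certified, `Cruxes/TPToTraversalBound/Lines/exit-mass-unforced-dive-obstruction.md` with the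
exact-computation scripts attached to the item) have `n = 2s + 4` canonical clock traversals and exactly `p* = 2`
collectible charges for every `s` (vertex-adjacency SEALS make the lattice index jump `0 → 2s+1` at a step where nothing
is judged; inside the forced snake every landing has index `idx(tip) − 1`, so clause (b) of `Targets` fails).  The same
certificate run with a MULTI-CENTRE menu of 964 grid annuli `A(z, r', 3r')` collects `64, 79, 99, 119` chained charges
for `s = 1..4` and none inside the forced snake, but multi-centre menus die QUANTITATIVELY (entropy `C₀²` per step against the
one-point cost `C₀^{-2/3}`, note §9); the viable repair recorded there is R2: a second seed `NoMacroSeal` (no macroscopic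
vertex-adjacency seals, heuristic rate `δ^{11/12}`) under which the same-centre KS count should port (note §9, handed back).  The helpers this stub would have used
are LANDED and clock-independent: `hasNTrav_of_hasTraversals` (p141501), `travSeq_of_hasNTrav` (p141412), the
TravSeq/Targets transport Aux (p141955).  Original docstring follows.

**Stub 4 (L–XL) — lattice Kemppainen–Smirnov Prop. 3.5 / Lemma 3.6 and Aizenman–Burchard:
`UnforcedDiveBound → MultiDiveBound → SAWTraversalBound`** (verbatim `power-law-tp2` stub 5; the raw dive bound is
passed as well, so that the prover may condition at adaptive stopping times where the pattern form is too rigid).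
Fix `(D,a,b)`, `ε := 1/64`, `C₀ = C₀(ε)`, `δ₀ = δ₀(ε)`.  For a shell `D(x;ρ,R)` with `R ≥ 4C₀³ρ` put `r := ρ + δ`,
clock `A₂ = A(x, C₀ r, C₀² r)`, charged annuli `A₁ = A(x, r, C₀ r)`, `A₂`, `A₃ = A(x, C₀² r, C₀³ r)`.
(i) `Curve.HasTraversals k x ρ R` for the mesh polyline forces `k` lattice traversals of `A(x, r, C₀³ r)`
(`PolylineShellTraversals` / `VertexShellTraversals` material).  (ii) KS Lemma 3.6 on the lattice: along the clock
traversals the `A₂`-index changes by `±1`; two consecutive increases ⇒ the latter `A₂`-traversal lands in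
`Targets_{A₂}` judged at the earlier clock time; a final increase ⇒ the next traversal of `A₁` or `A₃` lands in the
corresponding targets judged at the preceding clock time; hence `n` traversals carry `≥ (n - n₀)/2` charges, `n₀` =
index at time `0`.  (iii) `n₀ ≤ m_D(x,ρ,R) < ∞` uniformly in `δ ≤ δ₀` from the modulus of continuity of the Jordan
boundary (as `⌊1/θ(ρ)⌋` in `Percolation.bondExploration_traversalBound_holds`) and `IsEndpointApprox`.  (iv) As in
KS Prop. 3.5: `P(n traversals) ≤ 4^{n} ε^{(n-n₀)/2} ≤ 2^{-(n - 3n₀)}`.  (v) `k(x,ρ,R) := 3 m_D + ⌈3 log₂(R/ρ)⌉ + 4`,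
`λ := 3`, `K := (4C₀³)^3`; law `= (weight univ)⁻¹ • weight` (`Negative.law_apply_le_one` for the trivial range).
Why it might fail: (ii) is KS's topological lemma re-proved for lattice slit graphs with the index/avoidability dive
notion (deep starts weaken the `±1` step), and KS's "(n-n₀)/2 applications of G3" needs the adaptive conditioning of
(iv).  Sources: arXiv:1212.6215 Prop. 3.5, Lemma 3.6 (held text pp. 14–15); AizenmanBurchardDuke1999 App. A;
`Literature.Probability.Percolation.bondExploration_traversalBound_holds` (template);
`…Radial.traversalBoundAt_of_shellTightAt` / `Negative.traversalBound_iff_threshold_ge`, `Negative.allMesh_iff`. -/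
theorem stub_traversalBound_of_multiDive :
    UnforcedDiveBound → MultiDiveBound → SAWTraversalBound := by
  sorry

/-! ## Composition (kernel-checked; no `sorry` of its own) -/

/-- Pure-logic glue with the four stub statements as explicit hypotheses: the crux's own hypotheses
`BoundaryTP2`, `CriticalBubbleBound` and the line's provable input `CriticalExitMass` feed the seed; the chain
seed → multi-dive → traversal bound ends in `SAWTraversalBound`. -/
theorem glue (h₁ : CriticalExitMass)
    (h₂ : BoundaryTP2 → CriticalBubbleBound → CriticalExitMass → UnforcedDiveBound)
    (h₃ : UnforcedDiveBound → MultiDiveBound)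
    (h₄ : UnforcedDiveBound → MultiDiveBound → SAWTraversalBound) :
    BoundaryTP2 → CriticalBubbleBound → SAWTraversalBound :=
  fun hTP hB =>
    have hU : UnforcedDiveBound := h₂ hTP hB h₁
    h₄ hU (h₃ hU)

/-- **`TPToTraversalBound` from the four registered stubs** (concludes the crux BY NAME; depends on the stubs'
`sorry`s and on nothing else). -/
theorem TPToTraversalBound_of : TPToTraversalBound :=
  glue stub_criticalExitMass stub_unforcedDive stub_multiDive_of_unforced stub_traversalBound_of_multiDive

end

end Summit.CriticalPhenomena.SAWScalingLimit.Cruxes.TPToTraversalBound.ExitMassUnforcedDive
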